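import Mathlib.Data.ZMod.Basic
import Mathlib.LinearAlgebra.Matrix.Block
import Mathlib.LinearAlgebra.Matrix.Kronecker
import Mathlib.LinearAlgebra.Matrix.ConjTranspose
import Mathlib.Analysis.SpecialFunctions.Trigonometric.Basic
import HarnessLib

/-!
# Product-flux sector vocabulary (route SpectralDefectExtinction, crux `WindowExtinction`, line free-volume-heavy-witness r6)

Objects posited by reshape r6 of the line (lead prover-line-stmt-QuantumFields-8964-c4-0): the explicit matrices into which the
Hermitian Wilson–Dirac operator `Γ₅ D_W(V_[m], m₀, 1)` of Lüscher's flux-sector field at the two-plane tensor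
`(m₀₁, m₂₃) = (jL, j′L)` block-diagonalises over the `L²` characters `(k₁, k₃) ∈ (ℤ/L)²` (the field is `U₀ = U₂ = 1`,
`U₁(x) = e^{2πijx₀/L}`, `U₃(x) = e^{2πij′x₂/L}`, translation-invariant in `x₁, x₃`):

* `ringSin L`, `ringCos L` — the symmetric difference `(v(x+1) − v(x−1))/(2i)` and half neighbour sum on the ring `ℤ/L`;
* `ringPhase L j k x = 2πk/L + 2πjx/L` — the winding phase (`j` windings, character `k`);
* `ringZ L j k = ŝ + i·sin Φ` — the 1D ring "lattice Dirac oscillator"; `ringW L j k = 2 − ĉ − cos Φ` — the ring Wilson term;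
* `ringDirac L j k m = [[m + W, 𝔷ᴴ],[𝔷, −(m + W)]]` — the one-plane (ring) Wilson–Dirac Hamiltonian of a sector;
* `sectorK`, `sectorZ`, `sectorH = [[K, Ẑᴴ],[Ẑ, −K]]` — the sector operator (`K = h_A(m) ⊗ 1 + σᶻ ⊗ W_B`, `Ẑ = 1 ⊗ 𝔷_B`,
  `A` = plane `(2,3)` with ring parameters `(−j′, −k₃)`, `B` = plane `(0,1)` with `(j, k₁)`).

The decomposition itself (`charpoly (Γ₅ D_W) = ∏_k charpoly (sectorH …)`, validated numerically to `10⁻¹⁴` on `L = 3`) and the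
index count are theorems of the line's stub files; this file only fixes the vocabulary.  Conventions of the tree: `wilsonDirac`,
`euclideanGamma` (chiral), `gammaFive = diag(1,1,−1,−1)` (`Literature/MathematicalPhysics/QuantumLattice/GrassmannIntegral.lean`).
-/

noncomputable section

namespace Summit.QuantumFields.QCD.Cruxes.WindowExtinction.FreeVolumeHeavyWitness

open Matrix
open scoped Kronecker

/-- The lattice "sine" (symmetric difference) on the ring `ℤ/L`: `(ŝ v)(x) = (v(x+1) − v(x−1))/(2i)`; Hermitian, symbol `sin p`. -/
def ringSin (L : ℕ) : Matrix (ZMod L) (ZMod L) ℂ :=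
  Matrix.of fun x y => ((if y = x + 1 then (1 : ℂ) else 0) - (if x = y + 1 then (1 : ℂ) else 0)) / (2 * Complex.I)

/-- The lattice "cosine" on the ring `ℤ/L`: `(ĉ v)(x) = (v(x+1) + v(x−1))/2`; Hermitian, symbol `cos p`. -/
def ringCos (L : ℕ) : Matrix (ZMod L) (ZMod L) ℂ :=
  Matrix.of fun x y => ((if y = x + 1 then (1 : ℂ) else 0) + (if x = y + 1 then (1 : ℂ) else 0)) / 2

/-- The winding phase `Φ(x) = 2πk/L + 2πj·x/L` (`x = 0, …, L−1` through `ZMod.val`) of the ring with `j` windings and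
character `k`; well defined on the ring because `j ∈ ℤ`. -/
def ringPhase (L : ℕ) (j : ℤ) (k : ZMod L) (x : ZMod L) : ℝ :=
  2 * Real.pi * (k.val : ℝ) / L + 2 * Real.pi * (j : ℝ) * (x.val : ℝ) / L

/-- The ring "lattice Dirac oscillator" `𝔷 = ŝ + i·diag(sin Φ)` (an `L × L` matrix; `𝔷ᴴ = ŝ − i·diag(sin Φ)`). -/
def ringZ (L : ℕ) (j : ℤ) (k : ZMod L) : Matrix (ZMod L) (ZMod L) ℂ :=
  ringSin L + Matrix.diagonal fun x => Complex.I * (Real.sin (ringPhase L j k x) : ℂ)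

/-- The ring Wilson term `W = 2 − ĉ − diag(cos Φ)` (positive semidefinite). -/
def ringW (L : ℕ) (j : ℤ) (k : ZMod L) : Matrix (ZMod L) (ZMod L) ℂ :=
  (2 : ℂ) • (1 : Matrix (ZMod L) (ZMod L) ℂ) - ringCos L - Matrix.diagonal fun x => (Real.cos (ringPhase L j k x) : ℂ)

/-- The one-plane ring Wilson–Dirac Hamiltonian `h(m) = [[m + W, 𝔷ᴴ],[𝔷, −(m + W)]]` on `ℤ/L ⊕ ℤ/L` (the Hermitian Wilson
operator of a 2D torus with `jL` flux quanta, reduced to one character). -/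
def ringDirac (L : ℕ) (j : ℤ) (k : ZMod L) (m : ℝ) : Matrix (ZMod L ⊕ ZMod L) (ZMod L ⊕ ZMod L) ℂ :=
  Matrix.fromBlocks ((m : ℂ) • (1 : Matrix (ZMod L) (ZMod L) ℂ) + ringW L j k) (ringZ L j k)ᴴ (ringZ L j k)
    (-((m : ℂ) • (1 : Matrix (ZMod L) (ZMod L) ℂ) + ringW L j k))

/-- The even block `K = h_A(m) ⊗ 1 + σᶻ ⊗ W_B` of the sector operator at character `(k₁, k₃)` of the product-flux field
`(jL, j′L)`: `A` = plane `(2,3)` with ring parameters `(−j′, −k₃)`, `B` = plane `(0,1)` with `(j, k₁)`. -/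
def sectorK (L : ℕ) (j j' : ℤ) (k₁ k₃ : ZMod L) (m : ℝ) :
    Matrix ((ZMod L ⊕ ZMod L) × ZMod L) ((ZMod L ⊕ ZMod L) × ZMod L) ℂ :=
  ringDirac L (-j') (-k₃) m ⊗ₖ (1 : Matrix (ZMod L) (ZMod L) ℂ) +
    (Matrix.fromBlocks (1 : Matrix (ZMod L) (ZMod L) ℂ) 0 0 (-1)) ⊗ₖ ringW L j k₁

/-- The odd block `Ẑ = 1 ⊗ 𝔷_B` of the sector operator. -/
def sectorZ (L : ℕ) (j : ℤ) (k₁ : ZMod L) :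
    Matrix ((ZMod L ⊕ ZMod L) × ZMod L) ((ZMod L ⊕ ZMod L) × ZMod L) ℂ :=
  (1 : Matrix (ZMod L ⊕ ZMod L) (ZMod L ⊕ ZMod L) ℂ) ⊗ₖ ringZ L j k₁

/-- The **sector operator** `[[K, Ẑᴴ],[Ẑ, −K]]` (`4L²`-dimensional) at character `(k₁, k₃)` and mass `m` of the product-flux
field `(jL, j′L)`; `Γ₅ D_W(V_[(jL, j′L)], m, 1)` is unitarily equivalent to `⊕_{(k₁,k₃)} sectorH L j j′ k₁ k₃ m`. -/
def sectorH (L : ℕ) (j j' : ℤ) (k₁ k₃ : ZMod L) (m : ℝ) :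
    Matrix (((ZMod L ⊕ ZMod L) × ZMod L) ⊕ ((ZMod L ⊕ ZMod L) × ZMod L))
      (((ZMod L ⊕ ZMod L) × ZMod L) ⊕ ((ZMod L ⊕ ZMod L) × ZMod L)) ℂ :=
  Matrix.fromBlocks (sectorK L j j' k₁ k₃ m) (sectorZ L j k₁)ᴴ (sectorZ L j k₁) (-(sectorK L j j' k₁ k₃ m))

/-- `ringSin` is Hermitian: `ŝᴴ = ŝ` (the coefficient `1/(2i)` is purely imaginary and the stencil antisymmetric). -/
theorem ringSin_conjTranspose : ∀ (L : ℕ), (ringSin L)ᴴ = ringSin L := by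
  intro L
  ext x y
  simp only [ringSin, Matrix.conjTranspose_apply, Matrix.of_apply, star_div₀, star_sub, star_mul,
    Complex.star_def, Complex.conj_I, map_ofNat, apply_ite (starRingEnd ℂ), map_one, map_zero]
  have h : (2 : ℂ) * Complex.I ≠ 0 := mul_ne_zero two_ne_zero Complex.I_ne_zero
  field_simp
  ring_nf

/-- `ringCos` is Hermitian. -/
theorem ringCos_conjTranspose : ∀ (L : ℕ), (ringCos L)ᴴ = ringCos L := by
  intro L
  ext x y
  simp only [ringCos, Matrix.conjTranspose_apply, Matrix.of_apply, star_div₀, star_add,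
    Complex.star_def, map_ofNat, apply_ite (starRingEnd ℂ), map_one, map_zero]
  ring

end Summit.QuantumFields.QCD.Cruxes.WindowExtinction.FreeVolumeHeavyWitness

end
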